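import Literature.IUT.LogVolume.TameRadicalConvolution
import HarnessLib

/-!
# Isometries FIX the maximal order of the tame radical packet for EVERY tame index: `π^e = p`, `p ∤ e`

Classical local algebra (nothing disputed; the [IUTchIV] locator records where the abc-iut cell uses it).
`TameRadicalIsometryStable` (first rung) proves `(R_I)^∼ = {Σ_k π^k ⊗ l_k : ∀ k, ‖π^k l_k‖ ≤ 1}` for `K = ℚ_p(π)`,
`π^e = p`, `[K : ℚ_p] = e` WHEN `e ∣ p − 1` (`μ_e ⊂ ℚ_p`: field factors + discrete Fourier inversion).  THIS FILE removes
the restriction: the same identity — hence factorwise-isometry stability and «no isometric maximal-order mover» — holds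
for EVERY `e ≥ 1` with `p ∤ e`, i.e. at every TAME pure radical packet, Galois or not (`ℚ_p(p^{1/e})/ℚ_p` is Galois only
when `e ∣ p − 1`), by a `ζ`-free argument through FROBENIUS in the cyclic convolution ring of `TameRadicalConvolution`:
* `exists_box_repr_pow_prime` — for `z = Σ_k π^k ⊗ l_k` in the unit box, `z^p = Σ_k π^{pk} ⊗ l_k^p + p·r` with `r` in
  the box (the unit box is a SUBRING by the convolution formula; binomial congruence `exists_finset_sum_pow_prime_eq`);
* **`exists_unit_box_repr_pow_prime`** — if some `‖π^{k₀} l_{k₀}‖ = 1` then `z^p` again has a unit coordinate, at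
  `p·k₀ mod e`: `k ↦ p·k (mod e)` is INJECTIVE exactly when `p ∤ e` (the one place tameness enters — for `p ∣ e` it is
  not, cf. the wild movers of `WildQuadraticIsometryMover` (`ℚ₂(√2)`) / `WildCubicIsometryMover` (`ℚ₃(∛3)`)), so that
  coordinate is `p^{⌊pk₀/e⌋}·l_{k₀}^p + p·(integral)`; `exists_unit_box_repr_pow` — every power `z^n` keeps a unit
  coordinate (the box norm is power-multiplicative: the reduction `𝔽_p[ℤ/e]` of the box is reduced);
* **`norm_repr_le_of_mem_normalizedPacket_of_not_dvd`** — the unit box is INTEGRALLY CLOSED, so `(R_I)^∼ ⊆ box`: an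
  integral dependence `z^n = −Σ_{i<n} b_i z^i` over `R_I ⊆ box` bounds the coordinates of `z^n` by `M^{n−1}` (`M > 1` the
  box norm of `z`) while homogeneity produces one of absolute value `M^n`, and coordinates are unique;
* **`mem_normalizedPacket_iff_of_not_dvd`**, **`congr_image_normalizedPacket_eq_of_isometry_of_not_dvd`**,
  **`not_exists_isometry_mover_of_not_dvd`**, NON-VACUITY **`exists_tameRadical_isometry_stable_of_not_dvd`**
  (`ℚ_p(p^{1/e}) ⊆ ℚ̄_p`, every prime `p`, every `e ≥ 1` with `p ∤ e`).

Use (abc-iut cell, R-J row Y-29b «sign by place type»; the tame-cluster census clause left `e ∤ p − 1` OPEN): positive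
side of the dividing line at ALL tame radical packets; CONTAINERS only; S-IDLE on print-shaped data; no side is taken on
[IUTchIII] Cor. 3.12.  Proof-only file (theorems, no definitions).
[cite: Mochizuki2012, IUTchIV Prop. 1.1 p. 9, Prop. 1.4 (i) p. 13] [cite: NeukirchANT1999, Ch. II (5.5)]
-/

noncomputable section

open Metric Set
open scoped TensorProduct

namespace Literature.IUT.LogVolume

namespace TameRadical

variable {p : ℕ} [Fact p.Prime]
variable {K : Type} [NontriviallyNormedField K] [NormedAlgebra ℚ_[p] K] {π : K} {e : ℕ}

/-! ## Frobenius -/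

/-- **Finite-sum Frobenius congruence** in a commutative ring: `(Σ_{x∈s} a_x)^q = Σ_{x∈s} a_x^q + q·r` for a prime `q`.
[cite: NeukirchANT1999, Ch. II (5.5)] -/
theorem exists_finset_sum_pow_prime_eq {R : Type*} [CommRing R] {q : ℕ} (hq : q.Prime) {ι : Type*} (s : Finset ι)
    (a : ι → R) : ∃ r : R, (∑ x ∈ s, a x) ^ q = ∑ x ∈ s, a x ^ q + q * r := by
  classical
  induction s using Finset.induction_on with
  | empty => exact ⟨0, by rw [Finset.sum_empty, Finset.sum_empty, zero_pow hq.ne_zero, mul_zero, add_zero]⟩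
  | insert x s hx ih =>
    obtain ⟨r₁, h₁⟩ := ih
    obtain ⟨r₂, h₂⟩ := exists_add_pow_prime_eq hq (a x) (∑ y ∈ s, a y)
    refine ⟨a x * (∑ y ∈ s, a y) * r₂ + r₁, ?_⟩
    rw [Finset.sum_insert hx, Finset.sum_insert hx, h₂, h₁]
    ring

/-- **Frobenius in the unit box**: for `z = Σ_k π^k ⊗ l_k` with all `‖π^k l_k‖ ≤ 1`,
`z^p = Σ_k π^{pk} ⊗ l_k^p + p·Σ_k π^k ⊗ r_k` with all `‖π^k r_k‖ ≤ 1` (the unit box is a subring of `K ⊗ K` by the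
convolution formula, and the binomial congruence is applied inside it). [cite: Mochizuki2012, IUTchIV Prop. 1.1 p. 9] -/
theorem exists_box_repr_pow_prime [IsUltrametricDist K] (he : 0 < e) (hπ : π ^ e = (p : K)) {l : Fin e → K}
    (hl : ∀ k : Fin e, ‖π ^ (k : ℕ) * l k‖ ≤ 1) :
    ∃ r : Fin e → K, (∀ k : Fin e, ‖π ^ (k : ℕ) * r k‖ ≤ 1) ∧
      (∑ k : Fin e, purePacket p (fun _ : Fin 2 => K) ![π ^ (k : ℕ), l k]) ^ p =
        ∑ k : Fin e, purePacket p (fun _ : Fin 2 => K) ![π ^ (p * (k : ℕ)), l k ^ p] +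
          (p : PacketAlgebra p (fun _ : Fin 2 => K)) *
            ∑ k : Fin e, purePacket p (fun _ : Fin 2 => K) ![π ^ (k : ℕ), r k] := by
  classical
  -- the unit box as a subring of `K ⊗ K`
  let S : Subring (PacketAlgebra p (fun _ : Fin 2 => K)) :=
    { carrier := {z | ∃ m : Fin e → K, (∀ k : Fin e, ‖π ^ (k : ℕ) * m k‖ ≤ 1) ∧
        z = ∑ k : Fin e, purePacket p (fun _ : Fin 2 => K) ![π ^ (k : ℕ), m k]}
      mul_mem' := by
        rintro _ _ ⟨m, hm, rfl⟩ ⟨m', hm', rfl⟩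
        refine ⟨_, fun k => ?_, sum_purePacket_mul he hπ m m'⟩
        have h := norm_pi_pow_mul_conv_le hπ zero_le_one zero_le_one hm hm' k
        rwa [mul_one] at h
      one_mem' := ⟨_, box_delta he, one_eq_sum_purePacket p he⟩
      add_mem' := by
        rintro _ _ ⟨m, hm, rfl⟩ ⟨m', hm', rfl⟩
        exact ⟨m + m', box_add hm hm', (sum_purePacket_add p m m').symm⟩
      zero_mem' := ⟨0, fun k => by rw [Pi.zero_apply, mul_zero, norm_zero]; exact zero_le_one, (sum_purePacket_zero p).symm⟩
      neg_mem' := by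
        rintro _ ⟨m, hm, rfl⟩
        exact ⟨-m, box_neg hm, (sum_purePacket_neg p m).symm⟩ }
  have hmem : ∀ k : Fin e, purePacket p (fun _ : Fin 2 => K) ![π ^ (k : ℕ), l k] ∈ S := fun k =>
    ⟨_, box_single zero_le_one (hl k), purePacket_pi_pow_eq_sum p k (l k)⟩
  obtain ⟨r, hr⟩ := exists_finset_sum_pow_prime_eq (Fact.out : p.Prime) Finset.univ
    (fun k : Fin e => (⟨_, hmem k⟩ : S))
  obtain ⟨m, hm, hmr⟩ := r.2
  refine ⟨m, hm, ?_⟩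
  have h := congrArg S.subtype hr
  rw [map_pow, map_sum, map_add, map_mul, map_natCast, map_sum] at h
  have h1 : ∀ k : Fin e, S.subtype ((⟨_, hmem k⟩ : S) ^ p) =
      purePacket p (fun _ : Fin 2 => K) ![π ^ (p * (k : ℕ)), l k ^ p] := by
    intro k
    rw [map_pow, Subring.subtype_apply, purePacket_pow]
    congr 1; funext i; fin_cases i
    · exact (pow_mul' π p k).symm
    · rfl
  rw [Finset.sum_congr rfl fun k _ => h1 k] at h
  have h2 : S.subtype r = ∑ k : Fin e, purePacket p (fun _ : Fin 2 => K) ![π ^ (k : ℕ), m k] := by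
    rw [Subring.subtype_apply]; exact hmr
  rw [h2] at h
  exact h

/-- `k ↦ p·k (mod e)` is injective on `{0, …, e−1}` when `p ∤ e`. [cite: NeukirchANT1999, Ch. II (5.5)] -/
theorem eq_of_mul_mod_eq (hpe : ¬ p ∣ e) {k k' : Fin e} (h : (p * (k : ℕ)) % e = (p * (k' : ℕ)) % e) : k = k' := by
  have hcop : Nat.gcd e p = 1 := (Nat.coprime_comm.mp ((Nat.Prime.coprime_iff_not_dvd Fact.out).mpr hpe))
  exact Fin.ext (Nat.ModEq.eq_of_lt_of_lt (Nat.ModEq.cancel_left_of_coprime hcop h) k.2 k'.2)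

/-- **A UNIT COORDINATE SURVIVES FROBENIUS** (`p ∤ e`): if `z = Σ_k π^k ⊗ l_k` lies in the unit box and
`‖π^{k₀} l_{k₀}‖ = 1`, then `z^p = Σ_k π^k ⊗ l'_k` lies in the unit box and `‖π^{i₀} l'_{i₀}‖ = 1` at `i₀ = p·k₀ mod e`
(the coordinate there is `p^{⌊pk₀/e⌋}·l_{k₀}^p + p·(integral)`, the first term of absolute value `‖π^{k₀} l_{k₀}‖^p = 1`
because NO OTHER `k` has `pk ≡ pk₀ (mod e)`). [cite: Mochizuki2012, IUTchIV Prop. 1.1 p. 9] [cite: NeukirchANT1999, Ch. II (5.5)] -/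
theorem exists_unit_box_repr_pow_prime [IsUltrametricDist K] (he : 0 < e) (hpe : ¬ p ∣ e) (hπ : π ^ e = (p : K))
    {l : Fin e → K} (hl : ∀ k : Fin e, ‖π ^ (k : ℕ) * l k‖ ≤ 1) {k₀ : Fin e} (hk₀ : ‖π ^ (k₀ : ℕ) * l k₀‖ = 1) :
    ∃ l' : Fin e → K, (∀ k : Fin e, ‖π ^ (k : ℕ) * l' k‖ ≤ 1) ∧ (∃ k : Fin e, ‖π ^ (k : ℕ) * l' k‖ = 1) ∧
      (∑ k : Fin e, purePacket p (fun _ : Fin 2 => K) ![π ^ (k : ℕ), l k]) ^ p =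
        ∑ k : Fin e, purePacket p (fun _ : Fin 2 => K) ![π ^ (k : ℕ), l' k] := by
  classical
  obtain ⟨r, hr, hF⟩ := exists_box_repr_pow_prime he hπ hl
  have hp1 : ‖(p : K)‖ < 1 := by
    rw [TameQuadratic.norm_p p]
    exact inv_lt_one_of_one_lt₀ (by exact_mod_cast (Fact.out : p.Prime).one_lt)
  -- the Frobenius part, regrouped by exponents mod `e`
  set c : Fin e → K := fun i => ∑ k : Fin e,
    if (p * (k : ℕ)) % e = (i : ℕ) then (p : K) ^ ((p * (k : ℕ)) / e) * l k ^ p else 0 with hc_def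
  have hsum : ∑ k : Fin e, purePacket p (fun _ : Fin 2 => K) ![π ^ (p * (k : ℕ)), l k ^ p] =
      ∑ i : Fin e, purePacket p (fun _ : Fin 2 => K) ![π ^ (i : ℕ), c i] := by
    rw [Finset.sum_congr rfl fun (k : Fin e) _ => purePacket_pi_pow_reduce (p := p) hπ (p * (k : ℕ)) (l k ^ p)]
    exact sum_purePacket_regroup p Finset.univ (fun k : Fin e => (p * (k : ℕ)) % e) (fun k _ => Nat.mod_lt _ he) _
  -- each term of `c i` has absolute value `‖π^k l_k‖^p ≤ 1` after multiplication by `π^i`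
  have hterm : ∀ (i k : Fin e), (p * (k : ℕ)) % e = (i : ℕ) →
      ‖π ^ (i : ℕ) * ((p : K) ^ ((p * (k : ℕ)) / e) * l k ^ p)‖ = ‖π ^ (k : ℕ) * l k‖ ^ p := by
    intro i k hik
    rw [← hik, norm_pi_pow_mod_mul hπ, pow_mul', ← mul_pow, norm_pow]
  have hc : ∀ i : Fin e, ‖π ^ (i : ℕ) * c i‖ ≤ 1 := by
    intro i
    rw [hc_def, Finset.mul_sum]
    refine IsUltrametricDist.norm_sum_le_of_forall_le_of_nonneg zero_le_one fun k _ => ?_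
    split_ifs with hik
    · rw [hterm i k hik]; exact pow_le_one₀ (norm_nonneg _) (hl k)
    · rw [mul_zero, norm_zero]; exact zero_le_one
  have hpr : ∀ i : Fin e, ‖π ^ (i : ℕ) * ((p : K) * r i)‖ < 1 := fun i => by
    rw [norm_pi_pow_mul_mul]
    exact mul_lt_one_of_nonneg_of_lt_one_left (norm_nonneg _) hp1 (hr i)
  refine ⟨c + fun i => (p : K) * r i, fun i => box_add hc (fun i => (hpr i).le) i,
    ⟨⟨(p * (k₀ : ℕ)) % e, Nat.mod_lt _ he⟩, ?_⟩, ?_⟩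
  · -- the unit coordinate at `i₀ = p k₀ mod e`
    set i₀ : Fin e := ⟨(p * (k₀ : ℕ)) % e, Nat.mod_lt _ he⟩ with hi₀_def
    have hci₀ : c i₀ = (p : K) ^ ((p * (k₀ : ℕ)) / e) * l k₀ ^ p := by
      rw [hc_def]
      dsimp only
      rw [Finset.sum_eq_single k₀]
      · rw [if_pos rfl]
      · intro k _ hk
        rw [if_neg]
        intro h
        exact hk (eq_of_mul_mod_eq hpe h)
      · intro h; exact absurd (Finset.mem_univ _) h
    have h1 : ‖π ^ (i₀ : ℕ) * c i₀‖ = 1 := by rw [hci₀, hterm i₀ k₀ rfl, hk₀, one_pow]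
    rw [Pi.add_apply, mul_add, IsUltrametricDist.norm_add_eq_max_of_norm_ne_norm, h1, max_eq_left (hpr i₀).le]
    rw [h1]; exact (ne_of_lt (hpr i₀)).symm
  · rw [hF, hsum, sum_purePacket_add p, natCast_eq_iota_one p, iota_one_mul_sum_purePacket p]

/-- Iteration: every `p^j`-th power keeps a unit coordinate. [cite: Mochizuki2012, IUTchIV Prop. 1.1 p. 9] -/
theorem exists_unit_box_repr_pow_prime_pow [IsUltrametricDist K] (he : 0 < e) (hpe : ¬ p ∣ e)
    (hπ : π ^ e = (p : K)) {l : Fin e → K} (hl : ∀ k : Fin e, ‖π ^ (k : ℕ) * l k‖ ≤ 1)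
    (hk₀ : ∃ k : Fin e, ‖π ^ (k : ℕ) * l k‖ = 1) (j : ℕ) :
    ∃ l' : Fin e → K, (∀ k : Fin e, ‖π ^ (k : ℕ) * l' k‖ ≤ 1) ∧ (∃ k : Fin e, ‖π ^ (k : ℕ) * l' k‖ = 1) ∧
      (∑ k : Fin e, purePacket p (fun _ : Fin 2 => K) ![π ^ (k : ℕ), l k]) ^ p ^ j =
        ∑ k : Fin e, purePacket p (fun _ : Fin 2 => K) ![π ^ (k : ℕ), l' k] := by
  induction j with
  | zero => exact ⟨l, hl, hk₀, by rw [pow_zero, pow_one]⟩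
  | succ j ih =>
    obtain ⟨l', hl', ⟨k, hk⟩, hlj⟩ := ih
    obtain ⟨l'', hl'', hk'', hl''j⟩ := exists_unit_box_repr_pow_prime he hpe hπ hl' hk
    exact ⟨l'', hl'', hk'', by rw [pow_succ, pow_mul, hlj, hl''j]⟩

/-- **THE BOX NORM IS POWER-MULTIPLICATIVE** (`p ∤ e`, `[K : ℚ_p] = e`): if `z = Σ_k π^k ⊗ l_k` lies in the unit box
with a unit coordinate, so does EVERY power `z^n` (`z^{p^j} = z^n·z^{p^j−n}` for `p^j ≥ n`; submultiplicativity and the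
previous statement). [cite: Mochizuki2012, IUTchIV Prop. 1.1 p. 9] [cite: NeukirchANT1999, Ch. II (5.5)] -/
theorem exists_unit_box_repr_pow [IsUltrametricDist K] (he : 0 < e) (hpe : ¬ p ∣ e) (hK : Module.finrank ℚ_[p] K = e)
    (hπ : π ^ e = (p : K)) {l : Fin e → K} (hl : ∀ k : Fin e, ‖π ^ (k : ℕ) * l k‖ ≤ 1)
    (hk₀ : ∃ k : Fin e, ‖π ^ (k : ℕ) * l k‖ = 1) (n : ℕ) :
    ∃ l' : Fin e → K, (∀ k : Fin e, ‖π ^ (k : ℕ) * l' k‖ ≤ 1) ∧ (∃ k : Fin e, ‖π ^ (k : ℕ) * l' k‖ = 1) ∧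
      (∑ k : Fin e, purePacket p (fun _ : Fin 2 => K) ![π ^ (k : ℕ), l k]) ^ n =
        ∑ k : Fin e, purePacket p (fun _ : Fin 2 => K) ![π ^ (k : ℕ), l' k] := by
  haveI : Nonempty (Fin e) := ⟨⟨0, he⟩⟩
  -- `z^n` and `z^{p^n − n}` lie in the unit box
  obtain ⟨c, hc, hcn⟩ := exists_box_repr_pow he hπ zero_le_one hl n
  obtain ⟨d, hd, hdn⟩ := exists_box_repr_pow he hπ zero_le_one hl (p ^ n - n)
  simp only [one_pow] at hc hd
  -- `z^{p^n}` has a unit coordinate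
  obtain ⟨l', _, ⟨k₁, hk₁⟩, hl'⟩ := exists_unit_box_repr_pow_prime_pow he hpe hπ hl hk₀ n
  have hle : n ≤ p ^ n := (Nat.lt_pow_self (Fact.out : p.Prime).one_lt).le
  have hprod : (∑ k : Fin e, purePacket p (fun _ : Fin 2 => K) ![π ^ (k : ℕ), l k]) ^ p ^ n =
      (∑ k : Fin e, purePacket p (fun _ : Fin 2 => K) ![π ^ (k : ℕ), c k]) *
        ∑ k : Fin e, purePacket p (fun _ : Fin 2 => K) ![π ^ (k : ℕ), d k] := by
    rw [← hcn, ← hdn, ← pow_add, Nat.add_sub_cancel' hle]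
  rw [hl', sum_purePacket_mul he hπ] at hprod
  have heq := eq_of_sum_purePacket_eq he hK hπ hprod
  -- the largest coordinate of `z^n` is a unit
  obtain ⟨k₂, _, hk₂⟩ := Finset.exists_max_image Finset.univ (fun k : Fin e => ‖π ^ (k : ℕ) * c k‖)
    Finset.univ_nonempty
  refine ⟨c, hc, ⟨k₂, le_antisymm (hc k₂) ?_⟩, hcn⟩
  have h := norm_pi_pow_mul_conv_le hπ (norm_nonneg _) zero_le_one (fun k => hk₂ k (Finset.mem_univ k)) hd k₁
  rw [mul_one, ← congrFun heq k₁, hk₁] at h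
  exact h

/-- **Lower bound for the coordinates of powers** (`p ∤ e`): if `‖π^{k₀} l_{k₀}‖ = M > 0` is the LARGEST coordinate
absolute value of `z = Σ_k π^k ⊗ l_k`, then `z^n` has a coordinate of absolute value `M^n` (homogeneity
`z = ι₁(π^{k₀}l_{k₀})·z₀` with `z₀` in the unit box with a unit coordinate). [cite: Mochizuki2012, IUTchIV Prop. 1.1 p. 9] -/
theorem exists_repr_pow_norm_eq [IsUltrametricDist K] (he : 0 < e) (hpe : ¬ p ∣ e) (hK : Module.finrank ℚ_[p] K = e)
    (hπ : π ^ e = (p : K)) {l : Fin e → K} {k₀ : Fin e}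
    (hmax : ∀ k : Fin e, ‖π ^ (k : ℕ) * l k‖ ≤ ‖π ^ (k₀ : ℕ) * l k₀‖) (hpos : 0 < ‖π ^ (k₀ : ℕ) * l k₀‖) (n : ℕ) :
    ∃ l' : Fin e → K, (∃ k : Fin e, ‖π ^ (k : ℕ) * l' k‖ = ‖π ^ (k₀ : ℕ) * l k₀‖ ^ n) ∧
      (∑ k : Fin e, purePacket p (fun _ : Fin 2 => K) ![π ^ (k : ℕ), l k]) ^ n =
        ∑ k : Fin e, purePacket p (fun _ : Fin 2 => K) ![π ^ (k : ℕ), l' k] := by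
  set c : K := π ^ (k₀ : ℕ) * l k₀ with hc_def
  have hc0 : c ≠ 0 := norm_pos_iff.mp hpos
  -- normalise: `l = c • l₀`, `l₀` in the unit box with a unit coordinate at `k₀`
  set l₀ : Fin e → K := fun k => c⁻¹ * l k with hl₀_def
  have hl₀ : ∀ k : Fin e, ‖π ^ (k : ℕ) * l₀ k‖ ≤ 1 := fun k => by
    rw [hl₀_def, norm_pi_pow_mul_mul, norm_inv, inv_mul_le_iff₀ hpos, mul_one]
    exact hmax k
  have hk₀ : ‖π ^ (k₀ : ℕ) * l₀ k₀‖ = 1 := by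
    rw [hl₀_def, norm_pi_pow_mul_mul, norm_inv, ← hc_def, inv_mul_cancel₀ hpos.ne']
  have hz : ∑ k : Fin e, purePacket p (fun _ : Fin 2 => K) ![π ^ (k : ℕ), l k] =
      iota p (fun _ : Fin 2 => K) 1 c * ∑ k : Fin e, purePacket p (fun _ : Fin 2 => K) ![π ^ (k : ℕ), l₀ k] := by
    rw [iota_one_mul_sum_purePacket p]
    refine Finset.sum_congr rfl fun k _ => ?_
    rw [hl₀_def]
    dsimp only
    rw [mul_inv_cancel_left₀ hc0]
  obtain ⟨l', _, ⟨k₁, hk₁⟩, hl'⟩ := exists_unit_box_repr_pow he hpe hK hπ hl₀ ⟨k₀, hk₀⟩ n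
  refine ⟨fun k => c ^ n * l' k, ⟨k₁, ?_⟩, ?_⟩
  · rw [norm_pi_pow_mul_mul, hk₁, mul_one, norm_pow]
  · rw [hz, mul_pow, hl', ← map_pow, iota_one_mul_sum_purePacket p]

/-! ## The unit box is integrally closed: `(R_I)^∼ ⊆ box` -/

variable [IsUltrametricDist K]

/-- **THE UNIT BOX IS INTEGRALLY CLOSED — `(R_I)^∼ ⊆ box` FOR EVERY TAME INDEX** (`p ∤ e`, `[K : ℚ_p] = e`, `π^e = p`):
if `Σ_k π^k ⊗ l_k ∈ (R_I)^∼` then `‖π^i l_i‖ ≤ 1` for every `i`.  An integral dependence `z^n = −Σ_{j<n} b_j z^j` over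
`R_I ⊆ box` bounds every coordinate of `z^n` by `M^{n−1}`, `M` the box norm of `z`; if `M > 1` this contradicts the
coordinate of absolute value `M^n` of `exists_repr_pow_norm_eq`. [cite: Mochizuki2012, IUTchIV Prop. 1.1 p. 9] -/
theorem norm_repr_le_of_mem_normalizedPacket_of_not_dvd (he : 0 < e) (hpe : ¬ p ∣ e)
    (hK : Module.finrank ℚ_[p] K = e) (hπ : π ^ e = (p : K)) {l : Fin e → K}
    (hz : ∑ k : Fin e, purePacket p (fun _ : Fin 2 => K) ![π ^ (k : ℕ), l k] ∈ normalizedPacket p (fun _ : Fin 2 => K))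
    (i : Fin e) : ‖π ^ (i : ℕ) * l i‖ ≤ 1 := by
  classical
  haveI : Nonempty (Fin e) := ⟨⟨0, he⟩⟩
  by_contra hi
  rw [not_le] at hi
  -- the largest coordinate `M > 1`
  obtain ⟨k₀, _, hk₀⟩ := Finset.exists_max_image Finset.univ (fun k : Fin e => ‖π ^ (k : ℕ) * l k‖)
    Finset.univ_nonempty
  set M : ℝ := ‖π ^ (k₀ : ℕ) * l k₀‖ with hM_def
  have hmax : ∀ k : Fin e, ‖π ^ (k : ℕ) * l k‖ ≤ M := fun k => hk₀ k (Finset.mem_univ k)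
  have hM1 : 1 < M := hi.trans_le (hmax i)
  have hM0 : 0 ≤ M := norm_nonneg _
  set z := ∑ k : Fin e, purePacket p (fun _ : Fin 2 => K) ![π ^ (k : ℕ), l k] with hz_def
  -- an integral dependence over `R_I`
  rw [Literature.IUT.LogVolume.mem_normalizedPacket_iff] at hz
  obtain ⟨P, hPm, hP⟩ := hz
  set n := P.natDegree with hn_def
  have hn : n ≠ 0 := by
    intro h0
    rw [hn_def, hPm.natDegree_eq_zero] at h0
    rw [h0, Polynomial.eval₂_one] at hP
    haveI := nontrivial_packetAlgebra' p (fun _ : Fin 2 => K)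
    exact one_ne_zero hP
  rw [Polynomial.eval₂_eq_sum_range, Finset.sum_range_succ, hPm.coeff_natDegree, map_one, one_mul,
    add_eq_zero_iff_eq_neg'] at hP
  -- every term `b_j z^j`, `j < n`, has coordinates bounded by `M^{n−1}`
  have hterm : ∀ j ∈ Finset.range n, ∃ c : Fin e → K, (∀ k : Fin e, ‖π ^ (k : ℕ) * c k‖ ≤ M ^ (n - 1)) ∧
      (algebraMap (integerPacket p (fun _ : Fin 2 => K)) (PacketAlgebra p (fun _ : Fin 2 => K)) (P.coeff j)) * z ^ j =
        ∑ k : Fin e, purePacket p (fun _ : Fin 2 => K) ![π ^ (k : ℕ), c k] := by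
    intro j hj
    obtain ⟨β, hβ, hβe⟩ := exists_box_repr_of_mem_integerPacket he hK hπ (P.coeff j).2
    obtain ⟨c, hc, hce⟩ := exists_box_repr_pow he hπ hM0 hmax j
    refine ⟨_, fun k => ?_, by
      rw [Algebra.algebraMap_ofSubsemiring_apply, hβe, hz_def, hce, sum_purePacket_mul he hπ]⟩
    have h := norm_pi_pow_mul_conv_le hπ zero_le_one (pow_nonneg hM0 j) hβ hc k
    rw [one_mul] at h
    exact h.trans (pow_le_pow_right₀ hM1.le (Nat.le_sub_one_of_lt (Finset.mem_range.mp hj)))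
  choose! c hcb hce using hterm
  -- so `z^n = Σ_k π^k ⊗ d_k` with all `‖π^k d_k‖ ≤ M^{n−1}`
  have hupper : z ^ n = ∑ k : Fin e, purePacket p (fun _ : Fin 2 => K) ![π ^ (k : ℕ), (-∑ j ∈ Finset.range n, c j) k] := by
    rw [hP, sum_purePacket_neg p, sum_purePacket_finset_sum p]
    congr 1
    exact Finset.sum_congr rfl fun j hj => hce j hj
  have hdb : ∀ k : Fin e, ‖π ^ (k : ℕ) * (-∑ j ∈ Finset.range n, c j) k‖ ≤ M ^ (n - 1) :=
    box_neg (box_finset_sum (Finset.range n) (pow_nonneg hM0 _) hcb)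
  -- but `z^n` has a coordinate of absolute value `M^n`
  obtain ⟨l', ⟨k₁, hk₁⟩, hl'⟩ := exists_repr_pow_norm_eq he hpe hK hπ hmax (lt_trans zero_lt_one hM1) n
  rw [hz_def] at hupper; rw [hupper] at hl'
  have heq := congrFun (eq_of_sum_purePacket_eq he hK hπ hl') k₁
  have h := hdb k₁
  rw [heq, hk₁] at h
  exact absurd h (not_le.mpr (pow_lt_pow_right₀ hM1 (Nat.sub_one_lt hn)))

/-- **THE MAXIMAL ORDER OF EVERY TAME RADICAL PACKET** (`p ∤ e`, `[K : ℚ_p] = e`, `π^e = p`):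
`(R_I)^∼ = {Σ_{k<e} π^k ⊗ l_k : ∀ k, ‖π^k·l_k‖ ≤ 1}` — the first rung `e ∣ p − 1` of `TameRadical.mem_normalizedPacket_iff`
extended to all tame indices. [cite: Mochizuki2012, IUTchIV Prop. 1.1 p. 9] [cite: NeukirchANT1999, Ch. II (5.5)] -/
theorem mem_normalizedPacket_iff_of_not_dvd (he : 0 < e) (hpe : ¬ p ∣ e) (hK : Module.finrank ℚ_[p] K = e)
    (hπ : π ^ e = (p : K)) (z : PacketAlgebra p (fun _ : Fin 2 => K)) :
    z ∈ normalizedPacket p (fun _ : Fin 2 => K) ↔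
      ∃ l : Fin e → K, (∀ k : Fin e, ‖π ^ (k : ℕ) * l k‖ ≤ 1) ∧
        z = ∑ k : Fin e, purePacket p (fun _ : Fin 2 => K) ![π ^ (k : ℕ), l k] := by
  constructor
  · intro hz
    obtain ⟨B, hB⟩ := exists_basis he hK hπ
    obtain ⟨l, rfl⟩ := exists_repr B hB z
    exact ⟨l, norm_repr_le_of_mem_normalizedPacket_of_not_dvd he hpe hK hπ hz, rfl⟩
  · rintro ⟨l, hl, rfl⟩
    exact repr_mem_normalizedPacket he hπ hl

/-! ## Factorwise isometries -/

/-- **ISOMETRIES FIX THE MAXIMAL ORDER OF EVERY TAME RADICAL PACKET** (`p ∤ e`, `[K : ℚ_p] = e`, `π^e = p`): for all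
`ℚ_p`-linear isometries `f₀, f₁` of `K` and `z ∈ (R_I)^∼`, `(f₀ ⊗ f₁)(z) ∈ (R_I)^∼`.
[cite: Mochizuki2012, IUTchIV Prop. 1.1 p. 9] [cite: NeukirchANT1999, Ch. II (5.5)] -/
theorem congr_mem_normalizedPacket_of_isometry_of_not_dvd (he : 0 < e) (hpe : ¬ p ∣ e)
    (hK : Module.finrank ℚ_[p] K = e) (hπ : π ^ e = (p : K)) (f : ∀ _ : Fin 2, K ≃ₗ[ℚ_[p]] K)
    (hf : ∀ i x, ‖f i x‖ = ‖x‖) {z : PacketAlgebra p (fun _ : Fin 2 => K)}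
    (hz : z ∈ normalizedPacket p (fun _ : Fin 2 => K)) :
    (PiTensorProduct.congr f :
        PacketAlgebra p (fun _ : Fin 2 => K) ≃ₗ[ℚ_[p]] PacketAlgebra p (fun _ : Fin 2 => K)) z ∈
      normalizedPacket p (fun _ : Fin 2 => K) := by
  obtain ⟨l, hl, rfl⟩ := (mem_normalizedPacket_iff_of_not_dvd he hpe hK hπ z).mp hz
  obtain ⟨m, hm, hmeq⟩ := congr_repr_of_isometry he hK hπ f hf hl
  rw [hmeq]
  exact repr_mem_normalizedPacket he hπ hm

/-- **… and ONTO itself: `(f₀ ⊗ f₁)((R_I)^∼) = (R_I)^∼`** for every tame index (`p ∤ e`).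
[cite: Mochizuki2012, IUTchIV Prop. 1.1 p. 9] [cite: NeukirchANT1999, Ch. II (5.5)] -/
theorem congr_image_normalizedPacket_eq_of_isometry_of_not_dvd (he : 0 < e) (hpe : ¬ p ∣ e)
    (hK : Module.finrank ℚ_[p] K = e) (hπ : π ^ e = (p : K)) (f : ∀ _ : Fin 2, K ≃ₗ[ℚ_[p]] K)
    (hf : ∀ i x, ‖f i x‖ = ‖x‖) :
    (PiTensorProduct.congr f :
        PacketAlgebra p (fun _ : Fin 2 => K) ≃ₗ[ℚ_[p]] PacketAlgebra p (fun _ : Fin 2 => K)) ''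
        (normalizedPacket p (fun _ : Fin 2 => K) : Set (PacketAlgebra p (fun _ : Fin 2 => K))) =
      (normalizedPacket p (fun _ : Fin 2 => K) : Set (PacketAlgebra p (fun _ : Fin 2 => K))) := by
  have hf' : ∀ i x, ‖(f i).symm x‖ = ‖x‖ := fun i x => by
    conv_rhs => rw [← (f i).apply_symm_apply x]
    rw [hf]
  apply Set.Subset.antisymm
  · rintro _ ⟨z, hz, rfl⟩
    exact congr_mem_normalizedPacket_of_isometry_of_not_dvd he hpe hK hπ f hf hz
  · intro w hw
    exact ⟨_, congr_mem_normalizedPacket_of_isometry_of_not_dvd he hpe hK hπ (fun i => (f i).symm) hf' hw,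
      TameQuadratic.congr_congr_symm_apply f w⟩

/-- **NO ISOMETRIC MAXIMAL-ORDER MOVER EXISTS AT ANY TAME RADICAL PACKET** (`p ∤ e`): there is no pair (factorwise
`ℚ_p`-linear isometries `f`, point `z ∈ (R_I)^∼`) with `(⊗ f_i)(z) ∉ (R_I)^∼` — the negation of the exhibit shape
`hmove` of `Joshi/TestRealPinsMaxOrderMover`; the wild movers (`p ∣ e`: `ℚ₂(√2)`, `ℚ₃(∛3)`) are exactly where the
Frobenius reindexing `k ↦ pk (mod e)` fails to be injective. [cite: Mochizuki2012, IUTchIV Prop. 1.1 p. 9] -/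
theorem not_exists_isometry_mover_of_not_dvd (he : 0 < e) (hpe : ¬ p ∣ e) (hK : Module.finrank ℚ_[p] K = e)
    (hπ : π ^ e = (p : K)) :
    ¬ ∃ (f : ∀ _ : Fin 2, K ≃ₗ[ℚ_[p]] K) (_ : ∀ i x, ‖f i x‖ = ‖x‖) (z : PacketAlgebra p (fun _ : Fin 2 => K)),
      z ∈ (normalizedPacket p (fun _ : Fin 2 => K) : Set (PacketAlgebra p (fun _ : Fin 2 => K))) ∧
        (PiTensorProduct.congr f :
            PacketAlgebra p (fun _ : Fin 2 => K) ≃ₗ[ℚ_[p]] PacketAlgebra p (fun _ : Fin 2 => K)) z ∉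
          (normalizedPacket p (fun _ : Fin 2 => K) : Set (PacketAlgebra p (fun _ : Fin 2 => K))) := by
  rintro ⟨f, hf, z, hz, hnot⟩
  exact hnot (congr_mem_normalizedPacket_of_isometry_of_not_dvd he hpe hK hπ f hf hz)

end TameRadical

/-! ## Non-vacuity: `ℚ_p(p^{1/e}) ⊆ ℚ̄_p`, every `e ≥ 1` with `p ∤ e` -/

/-- **NON-VACUITY: AT `ℚ_p(p^{1/e})`, `p ∤ e`, FACTORWISE ISOMETRIES FIX THE MAXIMAL ORDER.**  For every prime `p` and every
`e ≥ 1` with `p ∤ e` there is a finite `E ⊆ ℚ̄_p` with `[E : ℚ_p] = e` (namely `E = ℚ_p(p^{1/e})`, totally and TAMELY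
ramified of index `e`, Galois over `ℚ_p` only if `e ∣ p − 1`) such that for ALL `ℚ_p`-linear isometries `f₀, f₁` of `E`
one has `(f₀ ⊗ f₁)((R_I)^∼) = (R_I)^∼` in `E ⊗_{ℚ_p} E`; the first rung `exists_tameRadical_isometry_stable` is the case
`e ∣ p − 1`. [cite: Mochizuki2012, IUTchIV Prop. 1.1 p. 9] [cite: NeukirchANT1999, Ch. II (5.5)] -/
theorem exists_tameRadical_isometry_stable_of_not_dvd (p : ℕ) [Fact p.Prime] {e : ℕ} (he : 0 < e) (hpe : ¬ p ∣ e) :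
    ∃ (E : IntermediateField ℚ_[p] (PadicAlgCl p)) (_ : FiniteDimensional ℚ_[p] E),
      Module.finrank ℚ_[p] E = e ∧
        ∀ (f : ∀ _ : Fin 2, (E : Type) ≃ₗ[ℚ_[p]] E), (∀ i x, ‖f i x‖ = ‖x‖) →
          (∀ i (r : ℝ), f i '' closedBall (0 : E) r = closedBall 0 r) ∧
            (PiTensorProduct.congr f :
                PacketAlgebra p (fun _ : Fin 2 => (E : Type)) ≃ₗ[ℚ_[p]] PacketAlgebra p (fun _ : Fin 2 => (E : Type))) ''
                (normalizedPacket p (fun _ : Fin 2 => (E : Type)) :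
                  Set (PacketAlgebra p (fun _ : Fin 2 => (E : Type)))) =
              (normalizedPacket p (fun _ : Fin 2 => (E : Type)) : Set (PacketAlgebra p (fun _ : Fin 2 => (E : Type)))) := by
  obtain ⟨E, π, hfd, hK, hπ⟩ := TameRadical.exists_subfield p he
  exact ⟨E, hfd, hK, fun f hf => ⟨fun i r => image_closedBall_eq_of_norm_map_eq p (f i) (hf i) r,
    TameRadical.congr_image_normalizedPacket_eq_of_isometry_of_not_dvd (K := E) he hpe hK hπ f hf⟩⟩

end Literature.IUT.LogVolume

end
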